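import Summits.ValiantsHypothesis.ValiantsHypothesis.Theorems.BarrierLeverPartitionMinorsSubsetSumCoordHalvable

/-!
# Route BarrierLever — item `PartitionMinorsHitByVP` (stmt-ValiantsHypothesis-19717):
# coordinate-halvable CLASSES for engine v2 — cosets of binary linear codes; «code × code» layouts are hit

Helper file (`--supports stmt-ValiantsHypothesis-19717`; cell valiant-natproofs, rung V4, 𝒟-side door (c),
prover seat val-np-p1 gen 9). Closes NO item; definition-free. Companion of `…SubsetSumCoordHalvable`
(engine v2: `IsSplittable` rows × `IsCoordHalvable` columns ⇒ hit, through val-np-p6 g3's additive door).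

* `isCoordHalvable_of_symmDiff_closed` — every family of `2^κ` subsets closed under triple symmetric difference
  (= a coset of a binary linear code: faces, even-weight demicubes, Hamming / Reed–Muller codes, …) halves
  recursively by coordinates (a coordinate on which the family is not constant; translation by `U₀ ∆ U₁` swaps
  the halves; deleting the coordinate is injective on the half containing it).
* **`partitionMinor_hit_code_code`** — UNCONDITIONAL: rows and columns both cosets of binary linear codes of the
  same size `2^κ` (any `κ ≤ h`, `h ≥ 2`): the layout is hit inside `SmallCircuits ℂ (h+h) 5`. Super-polynomial
  `r = 2^κ`; neither side needs to be a face.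
* `partitionMinor_hit_coordHalvable_of_cubeHalving` — CONDITIONAL on `CubeHalving h κ'` (`κ' ≤ κ`): ALL `2^κ` rows ×
  coordinate-halvable columns.

WHAT THIS IS NOT: nothing for columns without balanced coordinates (balls); no proof of `CubeHalving`; nothing on
crux 14610.
-/

set_option linter.dupNamespace false

namespace Summit.ValiantsHypothesis.ValiantsHypothesis.Theorems.BarrierLever.SubsetSum

open Finset MvPolynomial Literature.Barriers.ValiantsHypothesis
open scoped symmDiff

variable {h m : ℕ}

/-! ## 1. Cosets of binary linear codes are coordinate-halvable -/

/-- **Cosets of binary linear codes halve by coordinates.** A family of `2^κ` subsets of `Fin m` closed under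
triple symmetric difference is `IsCoordHalvable κ`. -/
theorem isCoordHalvable_of_symmDiff_closed : ∀ (κ : ℕ) (𝒲 : Finset (Finset (Fin m))),
    (∀ A ∈ 𝒲, ∀ B ∈ 𝒲, ∀ C ∈ 𝒲, A ∆ B ∆ C ∈ 𝒲) → 𝒲.card = 2 ^ κ → IsCoordHalvable κ 𝒲
  | 0, 𝒲, _, hcard => by simpa [IsCoordHalvable] using hcard
  | κ + 1, 𝒲, hΔ, hcard => by
    have h2 : 1 < 𝒲.card := by rw [hcard, pow_succ]; have := Nat.one_le_two_pow (n := κ); omega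
    obtain ⟨U₀, hU₀, U₁, hU₁, hne⟩ := Finset.one_lt_card.mp h2
    obtain ⟨i, hi⟩ : ∃ i, ¬ (i ∈ U₀ ↔ i ∈ U₁) := by
      by_contra hcon
      push Not at hcon
      exact hne (Finset.ext hcon)
    wlog h01 : i ∉ U₀ ∧ i ∈ U₁ generalizing U₀ U₁
    · have h10 : i ∉ U₁ ∧ i ∈ U₀ := by tauto
      exact this U₁ hU₁ U₀ hU₀ hne.symm (fun h' => hi h'.symm) h10
    obtain ⟨hi₀, hi₁⟩ := h01
    set D : Finset (Fin m) := U₀ ∆ U₁ with hD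
    have htrans : ∀ U ∈ 𝒲, U ∆ D ∈ 𝒲 := fun U hU => by
      rw [hD, ← symmDiff_assoc]; exact hΔ U hU U₀ hU₀ U₁ hU₁
    have hmemi : ∀ U : Finset (Fin m), i ∈ U ∆ D ↔ i ∉ U := fun U => by
      rw [Finset.mem_symmDiff, hD, Finset.mem_symmDiff]; tauto
    let Z := 𝒲.filter fun U => i ∉ U
    let Zc := 𝒲.filter fun U => i ∈ U
    have hinj : Function.Injective fun U : Finset (Fin m) => U ∆ D := fun U V hUV => by
      have := congrArg (· ∆ D) hUV
      simpa [symmDiff_symmDiff_cancel_right] using this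
    have himage : Zc.image (fun U => U ∆ D) = Z := by
      ext V
      simp only [Finset.mem_image, Finset.mem_filter, Z, Zc]
      constructor
      · rintro ⟨U, ⟨hU, hiU⟩, rfl⟩
        exact ⟨htrans U hU, (hmemi U).not.mpr (not_not.mpr hiU)⟩
      · rintro ⟨hV, hiV⟩
        exact ⟨V ∆ D, ⟨htrans V hV, (hmemi V).mpr hiV⟩, symmDiff_symmDiff_cancel_right _ _⟩
    have hZcard2 : Z.card + Z.card = 𝒲.card := by
      have hc := Finset.card_filter_add_card_filter_not (s := 𝒲) (fun U => i ∈ U)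
      have hcard1 : Zc.card = Z.card := by rw [← himage, Finset.card_image_of_injective _ hinj]
      rw [hcard1] at hc
      exact hc
    have hZcard : Z.card = 2 ^ κ := by rw [hcard, pow_succ] at hZcard2; omega
    have hZccard : Zc.card = 2 ^ κ := by
      have hc := Finset.card_filter_add_card_filter_not (s := 𝒲) (fun U => i ∈ U)
      rw [hcard, pow_succ] at hc
      change Zc.card + Z.card = _ at hc
      omega
    have herase_inj : Set.InjOn (fun W : Finset (Fin m) => W.erase i) ↑Zc := by
      intro A hA B hB hAB
      have hA' := (Finset.mem_filter.mp hA).2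
      have hB' := (Finset.mem_filter.mp hB).2
      rw [← Finset.insert_erase hA', ← Finset.insert_erase hB']
      exact congrArg (insert i) hAB
    have hZ1card : (Zc.image fun W => W.erase i).card = 2 ^ κ := by
      rw [Finset.card_image_of_injOn herase_inj, hZccard]
    refine ⟨i, hZcard, hZ1card, ?_, ?_⟩
    · refine isCoordHalvable_of_symmDiff_closed κ Z ?_ hZcard
      intro A hA B hB C hC
      rw [Finset.mem_filter] at hA hB hC ⊢
      refine ⟨hΔ A hA.1 B hB.1 C hC.1, ?_⟩
      simp only [Finset.mem_symmDiff]
      tauto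
    · refine isCoordHalvable_of_symmDiff_closed κ _ ?_ hZ1card
      intro A hA B hB C hC
      obtain ⟨A', hA', rfl⟩ := Finset.mem_image.mp hA
      obtain ⟨B', hB', rfl⟩ := Finset.mem_image.mp hB
      obtain ⟨C', hC', rfl⟩ := Finset.mem_image.mp hC
      have hA1 := (Finset.mem_filter.mp hA')
      have hB1 := (Finset.mem_filter.mp hB')
      have hC1 := (Finset.mem_filter.mp hC')
      refine Finset.mem_image.mpr ⟨A' ∆ B' ∆ C', Finset.mem_filter.mpr ⟨hΔ A' hA1.1 B' hB1.1 C' hC1.1, ?_⟩, ?_⟩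
      · simp only [Finset.mem_symmDiff]; tauto
      · ext x
        simp only [Finset.mem_erase, Finset.mem_symmDiff]
        by_cases hx : x = i
        · subst hx; simp [hA1.2, hB1.2, hC1.2]
        · simp [hx]

/-- **Code × code layouts are hit** (unconditional): rows and columns both cosets of binary linear codes of the
same size `2^κ` (triple-`∆`-closed injective families indexed by bit-vectors), `h ≥ 2`, `b = 5`. -/
theorem partitionMinor_hit_code_code (hh : 2 ≤ h) {κ : ℕ}
    (u w : (Fin κ → Bool) → Finset (Fin h)) (hu : Function.Injective u) (hw : Function.Injective w)
    (hΔu : ∀ i j k, u i ∆ u j ∆ u k ∈ univ.image u) (hΔw : ∀ i j k, w i ∆ w j ∆ w k ∈ univ.image w) :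
    ∃ f ∈ SmallCircuits ℂ (h + h) 5,
      (Matrix.of fun i j : Fin κ → Bool => MvPolynomial.coeff
        (∑ a ∈ u i, Finsupp.single (Fin.castAdd h a) 1 +
          ∑ c ∈ w j, Finsupp.single (Fin.natAdd h c) 1) f).det ≠ 0 := by
  refine partitionMinor_hit_of_isSplittable_isCoordHalvable hh u w hu hw ?_ ?_
  · refine isSplittable_of_symmDiff_closed κ _ ?_ ?_
    · intro A hA B hB C hC
      obtain ⟨i, -, rfl⟩ := Finset.mem_image.mp hA
      obtain ⟨j, -, rfl⟩ := Finset.mem_image.mp hB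
      obtain ⟨k, -, rfl⟩ := Finset.mem_image.mp hC
      exact hΔu i j k
    · rw [Finset.card_image_of_injective _ hu, Finset.card_univ, card_bv]
  · refine isCoordHalvable_of_symmDiff_closed κ _ ?_ ?_
    · intro A hA B hB C hC
      obtain ⟨i, -, rfl⟩ := Finset.mem_image.mp hA
      obtain ⟨j, -, rfl⟩ := Finset.mem_image.mp hB
      obtain ⟨k, -, rfl⟩ := Finset.mem_image.mp hC
      exact hΔw i j k
    · rw [Finset.card_image_of_injective _ hw, Finset.card_univ, card_bv]

/-- **All rows × coordinate-halvable columns, conditional on CUBE HALVING.** -/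
theorem partitionMinor_hit_coordHalvable_of_cubeHalving (hh : 2 ≤ h) {κ : ℕ}
    (H : ∀ κ' ≤ κ, CubeHalving h κ')
    (u w : (Fin κ → Bool) → Finset (Fin h)) (hu : Function.Injective u) (hw : Function.Injective w)
    (hcw : IsCoordHalvable κ (univ.image w)) :
    ∃ f ∈ SmallCircuits ℂ (h + h) 5,
      (Matrix.of fun i j : Fin κ → Bool => MvPolynomial.coeff
        (∑ a ∈ u i, Finsupp.single (Fin.castAdd h a) 1 +
          ∑ c ∈ w j, Finsupp.single (Fin.natAdd h c) 1) f).det ≠ 0 := by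
  refine partitionMinor_hit_of_isSplittable_isCoordHalvable hh u w hu hw ?_ hcw
  refine isSplittable_of_cubeHalving κ H _ ?_
  rw [Finset.card_image_of_injective _ hu, Finset.card_univ, card_bv]

end Summit.ValiantsHypothesis.ValiantsHypothesis.Theorems.BarrierLever.SubsetSum
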